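import Mathlib.FieldTheory.AlgebraicClosure
import Mathlib.RingTheory.Algebraic.Cardinality
import Mathlib.SetTheory.Cardinal.Subfield
import Literature.Computability.AlgebraicComplexity.MS2001StableObstructionMultiplicityComplex
import Literature.Computability.AlgebraicComplexity.PolystableBaseChange
import Literature.Computability.AlgebraicComplexity.FixedFormsBaseChange
import Literature.FieldTheory.AlgClosed.EmbeddingIntoComplex
import HarnessLib

/-!
# GCT I, Thm. 5.1 (multiplicity form) over EVERY algebraically closed field of characteristic `0`
# — discharge of `MS2001_thm_5_1` by the algebraic Lefschetz principle

Mulmuley–Sohoni, *Geometric complexity theory I*, SIAM J. Comput. 31 (2001), Thm. 5.1 («More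
generally, `W` is an obstruction for `(f, g)` if the multiplicity of the trivial `H`-representation
within `W` exceeds that of the trivial `Q`-representation»; AV p. 20, all.txt L1365–1390), typed
in the tree as the fact `MS2001_thm_5_1` (`MS2001ClassVarieties.lean` L407): over every
algebraically closed field `F` of characteristic `0`, for forms `f, g` of degree `m` with `f`
polystable, `∃ r, dim (Sym^r)^{Q} < dim (Sym^r)^{H}` (`Q`, `H` the `SL`-stabilisers of `g`, `f`)
implies `f ∉ Δ[g] = \overline{GL·g}`. The case `F = ℂ` is the tree theorem
`MS2001_thm_5_1_complex` (t02 g8, p513201; Kempf–Ness / Euclidean cone reduction / Reynolds over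
`ℂ`). THIS FILE proves **`MS2001_thm_5_1_holds : MS2001_thm_5_1`** (THEOREMS ONLY, no new facts)
by base change, not by re-proving the invariant theory over `F`:

1. DESCENT `F → k`: the finitely many coefficients of `f, g` lie in the relative algebraic closure
   `k` inside `F` of the subfield they generate — a COUNTABLE algebraically closed field of
   characteristic `0` (`Subfield.cardinalMk_closure_le_max`, `Algebra.IsAlgebraic.cardinalMk_le_max`,
   `algebraicClosure.isAlgClosure`); polystability descends (`IsPolystable.of_map`), orbit-closure
   membership descends (`mem_orbitClosure_of_map_mem`, `k` infinite), and the dimensions of the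
   fixed-form spaces are unchanged (`finrank_fixedForms_map`).
2. ASCENT `k → ℂ` along an embedding `k →+* ℂ` (tree:
   `Literature.FieldTheory.AlgClosed.nonempty_ringHom_complex_of_cardinalMk_le_continuum`, Steinitz):
   polystability ascends (`IsPolystable.map`, the generic-point argument), orbit-closure membership
   ascends (`map_mem_orbitClosure_map`), dimensions unchanged (`finrank_fixedForms_map`).
3. `MS2001_thm_5_1_complex` yields the contradiction.

Honest framing: this is Lefschetz-principle bookkeeping around a 2001 theorem at a known
separation; the invariant-theoretic content is the `ℂ` proof already in the tree. MS state the
theorem over an algebraically closed field of characteristic `0`; typed faithfully; now PROVED as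
typed. Nothing here bears on VP versus VNP.

## References

* K. D. Mulmuley, M. Sohoni, *Geometric complexity theory I: an approach to the P vs. NP and
  related problems*, SIAM J. Comput. 31 (2001) 496–526, Thm. 5.1 (AV p. 20).
  [MulmuleySohoniSIAM2001]
* J. S. Milne, *Algebraic Groups*, CUP (2017), §1 (base change; Prop. 1.11, Cor. 1.17, A.48).
  [Milne2017AlgebraicGroups]
* E. Steinitz, *Algebraische Theorie der Körper*, J. reine angew. Math. 137 (1910) §§22–24 (the
  embedding into `ℂ`; tree file `Literature/FieldTheory/AlgClosed/EmbeddingIntoComplex.lean`).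

## Provenance

Cell `val-lit`, seat `val-lit-x3` generation 5 (programme #10 «GCT I Thm 5.1 over every alg.
closed field of char 0 by algebraic base change», lead-bip RULING 2026-08-27 11:03Z; registry
claim `MS2001_thm_5_1`).
-/

noncomputable section

open MvPolynomial Cardinal

namespace Literature.Computability.AlgebraicComplexity

/-! ### § 1 Descending the coefficients to a countable algebraically closed subfield -/

section Subfield

variable {F : Type} [Field F]

/-- A polynomial all of whose coefficients lie in the range of `algebraMap k F` is the base change
of a polynomial over `k`. [cite: Milne2017AlgebraicGroups, §1.e (extension of scalars)] -/
theorem exists_map_eq_of_forall_coeff_mem_range {k : Type} [Field k] [Algebra k F] {σ : Type}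
    (f : MvPolynomial σ F) (h : ∀ d ∈ f.support, coeff d f ∈ Set.range (algebraMap k F)) :
    ∃ f₀ : MvPolynomial σ k, map (algebraMap k F) f₀ = f := by
  classical
  choose c hc using fun d : f.support => h d.1 d.2
  refine ⟨∑ d : f.support, monomial (d : σ →₀ ℕ) (c d), ?_⟩
  rw [map_sum]
  simp only [map_monomial, hc]
  conv_rhs => rw [f.as_sum, ← Finset.sum_coe_sort]

/-- **The coefficients of finitely many polynomials over an algebraically closed field `F` of
characteristic `0` lie in an algebraically closed subfield of cardinality `≤ 𝔠`** — the relative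
algebraic closure in `F` of the subfield generated by the (finitely many) coefficients; it embeds
into `ℂ` (Steinitz). This is the set-up of the algebraic Lefschetz principle (Milne §1;
tree `EmbeddingIntoComplex`). [cite: Milne2017AlgebraicGroups, §1.e (extension of scalars)] -/
theorem exists_algClosed_subfield_pair [IsAlgClosed F] [CharZero F] {σ : Type}
    (f g : MvPolynomial σ F) :
    ∃ (k : Type) (_ : Field k) (_ : Algebra k F) (_ : IsAlgClosed k) (_ : CharZero k),
      Nonempty (k →+* ℂ) ∧ (∃ f₀ : MvPolynomial σ k, map (algebraMap k F) f₀ = f) ∧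
        ∃ g₀ : MvPolynomial σ k, map (algebraMap k F) g₀ = g := by
  classical
  -- the subfield generated by the coefficients and its algebraic closure inside `F`
  let S : Finset F := f.support.image (fun d => coeff d f) ∪ g.support.image (fun d => coeff d g)
  let E : Subfield F := Subfield.closure (S : Set F)
  let k : IntermediateField E F := algebraicClosure E F
  haveI hk : IsAlgClosed k := IsAlgClosure.isAlgClosed E
  haveI : CharZero k := (algebraMap k F).charZero
  -- cardinality: `#k ≤ max #E ℵ₀ ≤ ℵ₀ ≤ 𝔠`
  have hE : #E ≤ ℵ₀ := by
    refine (Subfield.cardinalMk_closure_le_max (S : Set F)).trans (max_le ?_ le_rfl)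
    exact (Cardinal.lt_aleph0_of_finite _).le
  have hkcard : #k ≤ 𝔠 := by
    refine ((Algebra.IsAlgebraic.cardinalMk_le_max E k).trans ?_).trans Cardinal.aleph0_le_continuum
    exact max_le hE le_rfl
  have hemb : Nonempty (k →+* ℂ) :=
    Literature.FieldTheory.AlgClosed.nonempty_ringHom_complex_of_cardinalMk_le_continuum k hkcard
  -- every coefficient lies in `k`
  have hmem : ∀ x ∈ (S : Set F), x ∈ Set.range (algebraMap k F) := by
    intro x hx
    have hxE : x ∈ E := Subfield.subset_closure hx
    refine ⟨⟨x, ?_⟩, rfl⟩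
    have : x = algebraMap E F ⟨x, hxE⟩ := rfl
    rw [this]
    exact IntermediateField.algebraMap_mem k _
  refine ⟨k, inferInstance, inferInstance, hk, inferInstance, hemb,
    exists_map_eq_of_forall_coeff_mem_range f fun d hd => hmem _ ?_,
    exists_map_eq_of_forall_coeff_mem_range g fun d hd => hmem _ ?_⟩
  · exact Finset.mem_coe.mpr (Finset.mem_union_left _ (Finset.mem_image_of_mem _ hd))
  · exact Finset.mem_coe.mpr (Finset.mem_union_right _ (Finset.mem_image_of_mem _ hd))

end Subfield

/-! ### § 2 The discharge -/

/-- **GCT I, Thm. 5.1 (multiplicity form) holds over every algebraically closed field of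
characteristic `0`** — the tree's fact `MS2001_thm_5_1`, DISCHARGED: «`W` is an obstruction for
`(f, g)` if the multiplicity of the trivial `H`-representation within `W` exceeds that of the trivial
`Q`-representation» (`W = Sym^r`; `f` polystable; conclusion `f ∉ Δ[g]`). Proof by the algebraic
Lefschetz principle: descend `f, g` to a countable algebraically closed subfield `k ⊆ F`
(polystability, orbit-closure membership and the fixed-form dimensions are unchanged —
`IsPolystable.of_map`, `mem_orbitClosure_of_map_mem`, `finrank_fixedForms_map`), embed `k ↪ ℂ`
(Steinitz) and ascend (`IsPolystable.map`, `map_mem_orbitClosure_map`, `finrank_fixedForms_map`),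
then apply the `ℂ` theorem `MS2001_thm_5_1_complex`.
[cite: MulmuleySohoniSIAM2001, Thm. 5.1 (AV p.20, all.txt L1365–1390; journal Thm. 5.1)] -/
theorem MS2001_thm_5_1_holds : MS2001_thm_5_1 := by
  intro F _ _ _ σ _ _ f g m hf hg hst hr hmem
  classical
  obtain ⟨r, hr⟩ := hr
  obtain ⟨k, _, _, _, _, ⟨ψ⟩, ⟨f₀, hf₀⟩, ⟨g₀, hg₀⟩⟩ := exists_algClosed_subfield_pair f g
  -- (1) descent `F → k`
  have hst₀ : IsPolystable f₀ := IsPolystable.of_map (K := F) (by rw [hf₀]; exact hst)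
  have hmem₀ : f₀ ∈ orbitClosure g₀ :=
    mem_orbitClosure_of_map_mem (K := F) (by rw [hf₀, hg₀]; exact hmem)
  have hr₀ : Module.finrank k (fixedForms (slSubgroup σ k) g₀ r) <
      Module.finrank k (fixedForms (slSubgroup σ k) f₀ r) := by
    rw [← finrank_fixedForms_map (K := F) g₀ r, ← finrank_fixedForms_map (K := F) f₀ r, hf₀, hg₀]
    exact hr
  have hf₀hom : f₀.IsHomogeneous m :=
    MvPolynomial.IsHomogeneous.of_map (algebraMap k F).injective (by rw [hf₀]; exact hf)
  have hg₀hom : g₀.IsHomogeneous m :=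
    MvPolynomial.IsHomogeneous.of_map (algebraMap k F).injective (by rw [hg₀]; exact hg)
  -- (2) ascent `k → ℂ` along `ψ`
  letI : Algebra k ℂ := ψ.toAlgebra
  have hst₁ : IsPolystable (map (algebraMap k ℂ) f₀) := hst₀.map
  have hmem₁ : map (algebraMap k ℂ) f₀ ∈ orbitClosure (map (algebraMap k ℂ) g₀) :=
    map_mem_orbitClosure_map hmem₀
  have hr₁ : Module.finrank ℂ (fixedForms (slSubgroup σ ℂ) (map (algebraMap k ℂ) g₀) r) <
      Module.finrank ℂ (fixedForms (slSubgroup σ ℂ) (map (algebraMap k ℂ) f₀) r) := by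
    rw [finrank_fixedForms_map, finrank_fixedForms_map]
    exact hr₀
  -- (3) the `ℂ` theorem
  exact MS2001_thm_5_1_complex σ _ _ m (hf₀hom.map _) (hg₀hom.map _) hst₁ ⟨r, hr₁⟩ hmem₁

end Literature.Computability.AlgebraicComplexity

end
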